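import Mathlib
import Summits.ResolutionOfSingularities.ResolutionOfSingularities.Theorems.WeightedInvariantLocalWeightedDropWildMonicFlagDropKangarooCaseTwoCore
import Summits.ResolutionOfSingularities.ResolutionOfSingularities.Theorems.WeightedInvariantLocalWeightedDropWildMonicFlagSwapReading
import Summits.ResolutionOfSingularities.ResolutionOfSingularities.Theorems.WeightedInvariantLocalWeightedDropWildMonicFlagDropKangarooSplit

/-!
# S3ρ flag line, drop side: **Uk-ρD6 `DropKangarooShape` CASE (2)** — part B: the `n_G = 0` child flags of BOTH orientations at a
# translated point with both boundary components lost are strictly below the parent's maximum (Perlega Prop. 9.1.4 case (2))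

Crux item stmt-ResolutionOfSingularities-8899 `LocalWeightedDrop` (route `ResolutionOfSingularities/WeightedInvariant`), engine of the
door `HypersurfaceCentreConstruction` stmt-ResolutionOfSingularities-19897.  [OURS · L1 W4.3, chain w43, res-L1-w43-stub-2 (gen 4) on
target Uk-ρD6 of res-type-083's `…WildMonicFlagDropSplit` (`DropKangarooShape d p k`), CASE (2) = child flags with `n_G = 0`
(res-L1-w43-plan-1 DEALS gen 9 #18, res-type-083 CUT 2026-08-27T09:24:35Z): the two targets of record `DropKangarooFirst` and
`DropKangarooNewAxis` of res-type-083's split `…WildMonicFlagDropKangarooSplit` (`dropKangarooShape_of_cases`; the third type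
`DropKangarooTangent` = case (4), the kangaroo, is res-type-056's).  MAP: S. Perlega, arXiv:2011.14443 Ch. 9, Prop. 9.1.4 proof
case (2) (p0105 L52–L60: «Assume that `n_G = 0`, `t ≠ 0` and `E = V(xy)` … `G₁ = V(z′+g, y′+h)` or `G₁ = V(z′+g, x′)` … Since
`n_G < n_F`, this proves that `inv(G) < inv(F)`»).  Every object is OURS; nothing here is a statement of H. Hironaka's manuscript
[claim: Hironaka2017, status: under-review].]

With the child boundary `succE t E = {0}` (`t ≠ 0`): a child flag `(false, g, h)` is always an `n = 0` flag (`1 ∉ {0}`) and the core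
`exists_parent_flag_of_translated` (part A) gives a valid tangent parent flag `(g₀, t·X + X·h)` with `d_G ≤ d_F`, whence
`(d_G, 0, s_G) < (d_F, 1, 0) ≤ vmax`; a child flag `(true, g, h)` with `n = 0` has `h = 0` (`eq_zero_of_isN0_swapE_succE`) and is the
first-orientation flag `(swap g, 0)` read with the letters exchanged — same `d` (`newtonSet_flagTuple_swapT_zero`, `dRes_swap`), same
validity (`isMMax_swapT_zero_iff`), res-type-083's `…WildMonicFlagSwapReading` — so the core applies to `(swap g, 0)`.
AI-written; gate-accepted means sorry-free with standard axioms, not refereed.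
-/

set_option linter.dupNamespace false -- mandated namespace of this single-conjunct summit

noncomputable section

namespace Summit.ResolutionOfSingularities.ResolutionOfSingularities.Theorems

namespace WildMonic

open MvPowerSeries MonicDescent Literature.AlgebraicGeometry.Resolution
open Literature.AlgebraicGeometry.Resolution.HauserPerlega2024 (Triple)
open PurePowerFlag (swap swapE orient orientE IsN0 IsTangent succE)

variable {k : Type} [Field k] {d : ℕ}

/-! ## The triples: `(d_G, 0, s_G) < (d_F, 1, 0)` -/

/-- An `n = 0` triple is below an `n = 1` triple as soon as its `d` is not larger. -/
theorem toLex_zero_lt_toLex_one_of_le {a a' : ℕ} (s : ℕ∞) (h : a ≤ a') :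
    (toLex (a, toLex ((0 : ℕ), s)) : Triple) < toLex (a', toLex ((1 : ℕ), (0 : ℕ∞))) := by
  rcases h.lt_or_eq with hlt | heq
  · exact Prod.Lex.toLex_lt_toLex.mpr (Or.inl hlt)
  · exact Prod.Lex.toLex_lt_toLex.mpr (Or.inr ⟨heq, Prod.Lex.toLex_lt_toLex.mpr (Or.inl Nat.zero_lt_one)⟩)

/-- The triple of the tangent parent flag `(g₀, t·X + X·h)`: `(dFlagN d! 1 N, 1, 0)`. -/
theorem flagTriple_CX_add_X_mul {E : Finset (Fin 2)} (h1E : (1 : Fin 2) ∈ E) {t : k} (ht : t ≠ 0) (A : Fin d → MvPowerSeries (Fin 2) k)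
    (g₀ : MvPowerSeries (Fin 2) k) {h : PowerSeries k} (hh : PowerSeries.constantCoeff h = 0) :
    flagTriple d A E g₀ (PowerSeries.C t * PowerSeries.X + PowerSeries.X * h) =
      toLex (dFlagN d.factorial 1 (newtonSet (flagTuple d A g₀ (PowerSeries.C t * PowerSeries.X + PowerSeries.X * h))),
        toLex ((1 : ℕ), (0 : ℕ∞))) := by
  have hnotN0 : ¬ IsN0 E (PowerSeries.C t * PowerSeries.X + PowerSeries.X * h) := fun hn =>
    hn.elim (fun h1 => h1 h1E) fun h0 => by
      have h1 := order_CX_add_X_mul ht hh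
      rw [h0, PowerSeries.order_zero] at h1
      exact WithTop.top_ne_one h1
  rw [flagTriple_of_not_isN0 hnotN0, tangency_CX_add_X_mul ht hh]

/-! ## The two `n = 0` targets of `…WildMonicFlagDropKangarooSplit`, by name -/

/-- **`DropKangarooFirst` — PERLEGA PROP. 9.1.4 CASE (2), FIRST ORIENTATION, IN THE GAME.**  Over a perfect field of characteristic `p`:
at the translated successor (`t ≠ 0`, both letters boundary) every valid child flag `(false, g, h)` — an `n = 0` flag, the child's boundary
being `{D_new}` — is STRICTLY below the parent's maximum: it is dominated through `n` (`0 < 1`) by the valid tangent parent flag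
`(g₀, t·X + X·h)` of `exists_parent_flag_of_translated`.
[cite: Perlega2020, Prop. 9.1.4 proof case (2) (arXiv:2011.14443 Ch. 9, p0105 L52–L60)] -/
theorem dropKangarooFirst (p : ℕ) [Fact p.Prime] [CharP k p] [PerfectRing k p] (hd : 0 < d) : DropKangarooFirst d p k := by
  classical
  intro A E t T φ' vmax hstep g h hg hh hmm
  obtain ⟨hA, hexA, -, -, hge, ht, h0E, h1E, hT, -, hpos', hex'⟩ := hstep
  rw [succE_of_ne_zero ht] at hmm ⊢
  obtain ⟨g₀, hg₀0, hmmP, hdle⟩ := exists_parent_flag_of_translated p hd hA hexA ht h0E h1E hT hpos' hex' hg hh hmm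
  have h1E' : (1 : Fin 2) ∉ ({0} : Finset (Fin 2)) := by decide
  rw [flagTriple_of_isN0 (Or.inl h1E' : IsN0 {0} h)]
  refine lt_of_lt_of_le (toLex_zero_lt_toLex_one_of_le _ hdle) ?_
  rw [← flagTriple_CX_add_X_mul h1E ht A g₀ hh]
  exact hge _ (isFlagTriple_of_first hg₀0 (constantCoeff_CX_add_X_mul t h) (Or.inr (isTangent_CX_add_X_mul h0E h1E ht hh)) hmmP)

/-- **`DropKangarooNewAxis` — PERLEGA PROP. 9.1.4 CASE (2), THE FLAG ALONG THE EXCEPTIONAL CURVE (`G₁ = G₂ ∩ D_new`), IN THE GAME.**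
Over a perfect field of characteristic `p`: at the translated successor the valid child flag `(true, g, 0)` — curve `= D_new`, `n = 0` — is
STRICTLY below the parent's maximum: it is the first-orientation flag `(swap g, 0)` read with the letters exchanged (same `d`, same validity,
res-type-083's `…WildMonicFlagSwapReading`), which is dominated through `n` by the valid tangent parent flag `(g₀, t·X)` of
`exists_parent_flag_of_translated`.
[cite: Perlega2020, Prop. 9.1.4 proof case (2) (arXiv:2011.14443 Ch. 9, p0105 L52–L60)] -/
theorem dropKangarooNewAxis (p : ℕ) [Fact p.Prime] [CharP k p] [PerfectRing k p] (hd : 0 < d) : DropKangarooNewAxis d p k := by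
  classical
  intro A E t T φ' vmax hstep g hg hmm
  obtain ⟨hA, hexA, -, -, hge, ht, h0E, h1E, hT, -, hpos', hex'⟩ := hstep
  rw [succE_of_ne_zero ht] at hmm ⊢
  have hmm' : IsMMax d (shift d T φ') {0} (swap g) 0 := (isMMax_swapT_zero_iff _ _ g).mp hmm
  have hsg : constantCoeff (swap g) = 0 := by rw [swap, constantCoeff_rename]; exact hg
  obtain ⟨g₀, hg₀0, hmmP, hdle⟩ :=
    exists_parent_flag_of_translated p hd hA hexA ht h0E h1E hT hpos' hex' hsg (map_zero _) hmm'
  rw [flagTriple_of_isN0 (Or.inr rfl : IsN0 (swapE ({0} : Finset (Fin 2))) (0 : PowerSeries k)), newtonSet_flagTuple_swapT_zero,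
    dRes_swap]
  refine lt_of_lt_of_le (toLex_zero_lt_toLex_one_of_le _ hdle) ?_
  rw [← flagTriple_CX_add_X_mul h1E ht A g₀ (map_zero _)]
  exact hge _ (isFlagTriple_of_first hg₀0 (constantCoeff_CX_add_X_mul t 0)
    (Or.inr (isTangent_CX_add_X_mul h0E h1E ht (map_zero _))) hmmP)

end WildMonic

end Summit.ResolutionOfSingularities.ResolutionOfSingularities.Theorems

end
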